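import Summits.BirchSwinnertonDyer.BirchSwinnertonDyer.Theorems.TameQuarticSolventSolventPairLowerBoundTwistDatumOfFriedbergHoffstein
import Literature.NumberTheory.EllipticCurves.NonvanishingTwistsRealQuadraticTameAtThree
import HarnessLib

/-!
# Route `TameQuarticSolvent`, crux `SolventPairLowerBound` (stmt-BirchSwinnertonDyer-21391), line `birth` —
# the ANALYTIC HALF of stub `stub_kolyvaginTwistedUpperOverK` (K2(a)): a totally positive `β ∈ K = ℚ(√d)` of odd
# valuation above `3` with `L((E_K)^{(β)}, s)` entire and `L((E_K)^{(β)}, 1) ≠ 0`, from Friedberg–Hoffstein over `K`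

HONEST FRAMING. Theorems only; helper (`--supports stmt-BirchSwinnertonDyer-21391 --as helper`, width seat
`bsd-wall-tqs-p1-w2`). The registered stub `stub_kolyvaginTwistedUpperOverK` (skeleton v4) asks, for `W` on the leaf,
every `d > 0` with `ord₃ d = 1` and every quadratic `K ∋ θ₁`, `θ₁² = d`, for SOME `β ∈ K` of odd valuation above `3`,
totally positive, and a model `Vβ ≅ (W_K)^{(β)}` with: entire `L`-function, `Ш[3^∞]` finite, `#Ш_an ∈ ℚ`, and
`ord₃ #Ш(Vβ)[3^∞] ≤ ord₃ #Ш_an(Vβ)`. This file proves its ANALYTIC HALF — the existence of `β` with the two local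
properties, `L` entire and `L(1) ≠ 0` (so that the Euler-system half may be asked in analytic rank ZERO) — for every
`W` on the leaf that has an ODD prime `ℓ₀ ≠ 3` of multiplicative reduction (3 462 of the 3 533 census classes; memo
`Cruxes/SolventPairLowerBound/PARITY-K2A-w2.md`), GIVEN modularity (`exists_isNewformOf`) and the two named facts
`friedbergHoffstein_exists_twist_ne_zero_realQuadratic_tameAtThree{,_noflip}` (Friedberg–Hoffstein 1995 Thm. B (1)
over `K`, sign hypotheses discharged in print: Kobayashi 2002 Thm. 1.1). The Euler-system half (Kolyvagin /
Gross–Zagier–Zhang over the real quadratic `K` at the GOOD supersingular prime `𝔭 ∣ 3` of `E′`, big-image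
hypotheses at `3`) is NOT touched. BSD is not proved by any of this; no route file is imported.

Proof. `r_an(W) = 1 ⇒ w(W) = −1` (parity from modularity); (t′) at `3` ⇒ `ord₃ j ≥ 0` and Kodaira `III`/`III*`
(b2b dictionary); `w(W^{(d)}) ∈ {±1}`: if `+1`, the «flip» fact at a place `𝔮` of `K` above `ℓ₀` (such a place
exists: `ℓ₀` is not a unit of `𝓞 K` — the argument of the tree's
`BigHeckeGLn.exists_mem_asIdeal_natCast`, inlined); if `−1`, the «no-flip» fact.
-/

-- D-0017: single-problem summit, so `Summit.BirchSwinnertonDyer.BirchSwinnertonDyer.…` repeats a namespace BY DESIGN.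
set_option linter.dupNamespace false

noncomputable section

open scoped Classical NumberField

open IsDedekindDomain NumberField WeierstrassCurve
open Literature.NumberTheory.EllipticCurves
open Literature.NumberTheory.EllipticCurves.ModularForms

namespace Summit.BirchSwinnertonDyer.BirchSwinnertonDyer.Theorems.SolventPairLowerBound

/-- **The analytic half of `stub_kolyvaginTwistedUpperOverK` on the rows with an odd multiplicative prime.**
GIVEN modularity (`hmod`) and Friedberg–Hoffstein Thm. B (1) over the real quadratic field in the «flip» and
«no-flip» classes (`hFH`, `hFH'`): for every non-CM, globally minimal `W/ℚ`, additive of class (t′) at `3`, of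
analytic rank `1`, having an ODD prime `ℓ₀ ≠ 3` of multiplicative reduction, every `d > 0` with `ord₃ d = 1`, and
every quadratic number field `K ∋ θ₁` with `θ₁² = d`, there is `β ∈ K`, of odd valuation at every place above `3` and
positive at every real embedding, such that the twist `(W_K)^{(β)}` has an entire `L`-function NOT vanishing at
`s = 1`. (Case `w(W^{(d)}) = +1`: one unramified flip at a place over `ℓ₀`; case `w(W^{(d)}) = −1`: no flip.)
[cite: FriedbergHoffstein1995, Thm. B (1)] [cite: Kobayashi2002, Thm. 1.1 (i), (ii)] [cite: BCDTJAMS2001, Thm. A] -/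
theorem exists_totallyPositive_oddAtThree_twist_L_ne_zero_of_friedbergHoffstein (hmod : exists_isNewformOf)
    (hFH : friedbergHoffstein_exists_twist_ne_zero_realQuadratic_tameAtThree)
    (hFH' : friedbergHoffstein_exists_twist_ne_zero_realQuadratic_tameAtThree_noflip) :
    ∀ (W : WeierstrassCurve ℚ) [W.IsElliptic] [W.IsGloballyMinimal], ¬ W.HasCM →
      Literature.NumberTheory.EllipticCurves.Rank1Residual.Addv W 3 →
      Summit.BirchSwinnertonDyer.Rank1Residual.Additive.SubTprime W 3 → W.analyticRank = 1 →
      (∃ (ℓ₀ : ℕ) (_ : Fact ℓ₀.Prime), ℓ₀ ≠ 2 ∧ ℓ₀ ≠ 3 ∧ W.HasMultiplicativeReductionAtPrime ℓ₀) →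
      ∀ (d : ℤ), 0 < d → padicValInt 3 d = 1 →
      ∀ (K : Type) [Field K] [NumberField K] (θ₁ : K), Module.finrank ℚ K = 2 → θ₁ ^ 2 = (d : K) →
      ∃ β : K,
        (∀ v : HeightOneSpectrum (𝓞 K), ((3 : ℕ) : 𝓞 K) ∈ v.asIdeal →
          ∃ k : ℤ, v.valuation K β = WithZero.exp (2 * k + 1)) ∧
        (∀ σ : K →+* ℝ, 0 < σ β) ∧
        ((W.baseChange K).quadraticTwist β).HasEntireLFunction ∧
        ((W.baseChange K).quadraticTwist β).entireLFunction 1 ≠ 0 := by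
  intro W _ _ hCM hadd hsub hr hmult d hd hv K _ _ θ₁ h2 hθ₁
  obtain ⟨ℓ₀, _, hℓ2, hℓ3, hℓ⟩ := hmult
  have hw : W.rootNumber = -1 :=
    Summit.BirchSwinnertonDyer.Rank1Residual.O5.HeegnerLogTransport.rootNumber_eq_neg_one_of_analyticRank_eq_one
      hmod W hr
  have hj : 0 ≤ padicValRat 3 W.j := not_lt.mp hsub.1
  have hIII : W.kodairaSymbolAt (Summit.BirchSwinnertonDyer.Rank1Residual.Additive.placeOf 3) = .III ∨
      W.kodairaSymbolAt (Summit.BirchSwinnertonDyer.Rank1Residual.Additive.placeOf 3) = .IIIstar :=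
    (Summit.BirchSwinnertonDyer.Rank1Residual.Additive.subTprime_three_iff_kodairaSymbolAt_III_or_IIIstar
      W hadd).mp hsub
  have hdq : (d : ℚ) ≠ 0 := by exact_mod_cast hd.ne'
  haveI := W.isElliptic_quadraticTwist hdq
  rcases rootNumber_eq_one_or_eq_neg_one (W.quadraticTwist (d : ℚ)) with hwd | hwd
  · -- `w(W^{(d)}) = +1`: one unramified flip at a place `𝔮` of `K` above the odd multiplicative prime `ℓ₀`
    obtain ⟨𝔮, h𝔮⟩ : ∃ v : HeightOneSpectrum (𝓞 K), ((ℓ₀ : ℕ) : 𝓞 K) ∈ v.asIdeal := by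
      -- `ℓ₀` is not a unit of `𝓞 K` (its norm is `± ℓ₀^{[K:ℚ]}`), so some maximal ideal contains it
      have hp : ℓ₀.Prime := Fact.out
      have hnu : ¬ IsUnit ((ℓ₀ : 𝓞 K)) := fun h ↦ by
        have h1 := h.map (Algebra.norm ℤ)
        rw [← map_natCast (algebraMap ℤ (𝓞 K)) ℓ₀, Algebra.norm_algebraMap, Int.isUnit_iff_natAbs_eq,
          Int.natAbs_pow, Int.natAbs_natCast] at h1
        exact (Nat.one_lt_pow (Module.finrank_pos (R := ℤ) (M := 𝓞 K)).ne' hp.one_lt).ne' h1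
      obtain ⟨𝔪, h𝔪, hle⟩ := Ideal.exists_le_maximal (Ideal.span {(ℓ₀ : 𝓞 K)})
        (by rwa [Ne, Ideal.span_singleton_eq_top])
      refine ⟨⟨𝔪, h𝔪.isPrime, fun hbot ↦ ?_⟩, hle (Ideal.mem_span_singleton_self _)⟩
      have h := hle (Ideal.mem_span_singleton_self _)
      rw [hbot, Ideal.mem_bot] at h
      exact (Nat.cast_ne_zero.2 hp.ne_zero) h
    obtain ⟨β, hβpos, hβval, -, -, -, hL, hL1⟩ :=
      hFH W hCM hw hj hIII ℓ₀ hℓ2 hℓ3 hℓ d hd hv hwd K θ₁ h2 hθ₁ 𝔮 h𝔮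
    exact ⟨β, hβval, hβpos, hL, hL1⟩
  · -- `w(W^{(d)}) = −1`: no flip
    obtain ⟨β, hβpos, hβval, -, hL, hL1⟩ := hFH' W hCM hw hj hIII d hd hv hwd K θ₁ h2 hθ₁
    exact ⟨β, hβval, hβpos, hL, hL1⟩

end Summit.BirchSwinnertonDyer.BirchSwinnertonDyer.Theorems.SolventPairLowerBound

end
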